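import Mathlib
import Literature.Probability.LatticeModels.GKSInequalities
import HarnessLib

/-!
# Crux `PrecisionLaplacian.InverseMFerromagnet` (stmt-CriticalPhenomena-4798), line `Sketch` —
# stub `helper_marginal_twoSep` (core D, D7: marginalisation across a 2-separator)

THEOREM-ONLY file (no definitions).  Zero-field pair system `gksExpect univ K C` on `Fin n`
(`|C i| = 2`); every bond lies inside `A` or inside `B := insert c₁ (insert c₂ Aᶜ)`, `c₁ ≠ c₂ ∈ A`.
Write `S_A`, `S_B` for the unnormalised sums of the two sides' OWN systems (all `n` sites, only the
bonds `⊆ A`, resp. `⊄ A`, active), `S` for the full system, `t := σ_{c₁}σ_{c₂}`, `Z_• = S_•(1)`,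
`T_• = S_•(t)`, `r_• = T_•/Z_•`, `N = 2^n`.  **Key identity** (`marg_key`): for every observable `F`
of the spins in `A`, `N · S(F) = S_A(F) · Z_B + S_A(F t) · T_B`.  Indeed the right side is
`∑_{ω,ω'} F(ω)(1 + t(ω)t(ω')) w_A(ω) w_B(ω')`; reindex by the twisted swap `Φ` of Ginibre's
duplicated system (spins outside `A` of the two copies exchanged and multiplied by the relative sign
`σ_{c₁}(ω)σ_{c₁}(ω')`, an involution fixing the spins in `A`).  The factor `1 + t(ω)t(ω')` is twice
the indicator of the sector where the relative signs at `c₁`, `c₂` agree, and there the `B`-weight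
of the second copy of `Φ(ω,ω')` is `w_B(ω)` while `F`, `w_A` of the first copy are untouched; so the
sum is `∑_ω F w_A w_B ∑_{ω'}(1 + t(ω)t(ω')) = N · S(F)` (`∑_{ω'} t = 0`, `w_A w_B = w`).
Consequences: (i) `F = 1, t` give `N Z = Z_A Z_B + T_A T_B`, `N T = T_A Z_B + Z_A T_B`, whence
`⟨t⟩ = (r_A + r_B)/(1 + r_A r_B)`; (ii) `F = σ_pσ_q` (`p, q ∈ A`): the system "`A`-bonds plus one
bond `{c₁,c₂}` of coupling `J = ½ log((1+r_B)/(1−r_B)) = artanh r_B`" has sums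
`cosh J · S_A(f) + sinh J · S_A(f t) = (cosh J / Z_B) · N · S(f)` (`|r_B| < 1`: both signs of `t`
carry weight), so its `σ_pσ_q`-expectation is the full one.
-/

namespace Summit.CriticalPhenomena.Ising3DConformalLimit.Cruxes.InverseMFerromagnet.PartialCovarianceLadder

open Literature.Probability.LatticeModels Finset Matrix

/-- `(uv)² = 1` for signs `u² = v² = 1`. [folklore] -/
theorem marg_sign_sq {u v : ℝ} (hu : u * u = 1) (hv : v * v = 1) : u * v * (u * v) = 1 := by
  linear_combination (v * v) * hu + hv

/-- `w = w_A · w_B`: the bonds inside `A` and the remaining ones. [folklore] -/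
theorem marg_weight_split {n m : ℕ} (K : Fin m → ℝ) (C : Fin m → Finset (Fin n))
    (A : Finset (Fin n)) (ω : SpinConfig (Fin n)) :
    gksWeight Finset.univ K C ω
      = gksWeight (Finset.univ.filter fun i => C i ⊆ A) K C ω
          * gksWeight (Finset.univ.filter fun i => ¬ C i ⊆ A) K C ω := by
  rw [gksWeight, gksWeight, gksWeight, ← Real.exp_add]
  congr 1
  unfold gksHamiltonian
  exact (Finset.sum_filter_add_sum_filter_not _ _ _).symm

/-- The `A`-weight only sees the spins in `A`. [folklore] -/
theorem marg_weightA_congr {n m : ℕ} (K : Fin m → ℝ) (C : Fin m → Finset (Fin n))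
    (A : Finset (Fin n)) {ω ω' : SpinConfig (Fin n)} (h : ∀ z ∈ A, spinAt z ω' = spinAt z ω) :
    gksWeight (Finset.univ.filter fun i => C i ⊆ A) K C ω'
      = gksWeight (Finset.univ.filter fun i => C i ⊆ A) K C ω := by
  unfold gksWeight gksHamiltonian
  congr 1
  refine Finset.sum_congr rfl fun i hi => ?_
  rw [Finset.mem_filter] at hi
  unfold spinProduct
  rw [Finset.prod_congr rfl fun z hz => h z (hi.2 hz)]

/-- **`B`-weight transfer.** If on `insert c₁ (insert c₂ Aᶜ)` the spins of `ω'` are those of `ω`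
times a common sign `ε`, then `w_B(ω') = w_B(ω)`: every bond `⊄ A` lies inside that set and sees
`ε` twice. [folklore] -/
theorem marg_weightB_transfer {n m : ℕ} (K : Fin m → ℝ) (C : Fin m → Finset (Fin n))
    (hC : ∀ i, (C i).card = 2) (c₁ c₂ : Fin n) (A : Finset (Fin n))
    (hAB : ∀ i, C i ⊆ A ∨ C i ⊆ insert c₁ (insert c₂ Aᶜ)) {ω ω' : SpinConfig (Fin n)} {ε : ℝ}
    (hε : ε * ε = 1) (h : ∀ z ∈ insert c₁ (insert c₂ Aᶜ), spinAt z ω' = ε * spinAt z ω) :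
    gksWeight (Finset.univ.filter fun i => ¬ C i ⊆ A) K C ω'
      = gksWeight (Finset.univ.filter fun i => ¬ C i ⊆ A) K C ω := by
  unfold gksWeight gksHamiltonian
  congr 1
  refine Finset.sum_congr rfl fun i hi => ?_
  have hiB : C i ⊆ insert c₁ (insert c₂ Aᶜ) := (hAB i).resolve_left (Finset.mem_filter.1 hi).2
  obtain ⟨a, b, hab, hCi⟩ := Finset.card_eq_two.1 (hC i)
  have haC : a ∈ C i := by rw [hCi]; simp
  have hbC : b ∈ C i := by rw [hCi]; simp
  rw [hCi, spinProduct, spinProduct, Finset.prod_pair hab, Finset.prod_pair hab, h a (hiB haC),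
    h b (hiB hbC)]
  congr 1
  linear_combination (spinAt a ω * spinAt b ω) * hε

/-- **The restricted involution identity with split weights.** For an observable `F` of the spins
in `A`: `∑_{ω,ω'} F(ω)(1 + t(ω)t(ω')) w_A(ω) w_B(ω') = ∑_{ω,ω'} F(ω)(1 + t(ω)t(ω')) w_A(ω) w_B(ω)`.
Reindex by the twisted swap `Φ` of the duplicated system (outside `A`, exchange the two copies and
multiply by the relative sign `σ_{c₁}(ω)σ_{c₁}(ω')`; an involution as `c₁ ∈ A`): the factor
`1 + t(ω)t(ω')` vanishes unless the relative signs at `c₁`, `c₂` agree, and then the second copy of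
`Φ(ω, ω')` carries the `B`-weight `w_B(ω)` (`marg_weightB_transfer`). [folklore] -/
theorem marg_sum_swap {n m : ℕ} (K : Fin m → ℝ) (C : Fin m → Finset (Fin n))
    (hC : ∀ i, (C i).card = 2) (c₁ c₂ : Fin n) (A : Finset (Fin n)) (hc₁ : c₁ ∈ A) (hc₂ : c₂ ∈ A)
    (hAB : ∀ i, C i ⊆ A ∨ C i ⊆ insert c₁ (insert c₂ Aᶜ)) (F : SpinConfig (Fin n) → ℝ)
    (hF : ∀ ω ω' : SpinConfig (Fin n), (∀ z ∈ A, ω z = ω' z) → F ω = F ω') :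
    ∑ ω : SpinConfig (Fin n), ∑ ω' : SpinConfig (Fin n),
        F ω * (1 + spinAt c₁ ω * spinAt c₁ ω' * (spinAt c₂ ω * spinAt c₂ ω'))
          * (gksWeight (Finset.univ.filter fun i => C i ⊆ A) K C ω
            * gksWeight (Finset.univ.filter fun i => ¬ C i ⊆ A) K C ω')
      = ∑ ω : SpinConfig (Fin n), ∑ ω' : SpinConfig (Fin n),
        F ω * (1 + spinAt c₁ ω * spinAt c₁ ω' * (spinAt c₂ ω * spinAt c₂ ω'))
          * (gksWeight (Finset.univ.filter fun i => C i ⊆ A) K C ω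
            * gksWeight (Finset.univ.filter fun i => ¬ C i ⊆ A) K C ω) := by
  obtain ⟨Φ, hΦ⟩ : ∃ Φ : SpinConfig (Fin n) × SpinConfig (Fin n) →
      SpinConfig (Fin n) × SpinConfig (Fin n),
      Φ = fun pr => (fun z => if z ∈ A then pr.1 z else pr.1 c₁ * pr.2 c₁ * pr.2 z,
        fun z => if z ∈ A then pr.2 z else pr.1 c₁ * pr.2 c₁ * pr.1 z) := ⟨_, rfl⟩
  have hinv : Function.Involutive Φ := by
    rintro ⟨ω, ω'⟩
    subst hΦ
    have huu : ∀ a b d : ℤˣ, a * b * (a * b * d) = d := fun a b d => by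
      rw [← mul_assoc, Int.units_mul_self, one_mul]
    refine Prod.ext ?_ ?_ <;> funext z <;> by_cases hz : z ∈ A <;> simp [hz, hc₁, huu]
  -- the spins of the two copies after the swap
  have hfst : ∀ (pr : SpinConfig (Fin n) × SpinConfig (Fin n)) (z : Fin n), spinAt z (Φ pr).1
      = if z ∈ A then spinAt z pr.1 else spinAt c₁ pr.1 * spinAt c₁ pr.2 * spinAt z pr.2 := by
    intro pr z
    subst hΦ
    by_cases hz : z ∈ A <;> simp [spinAt, hz, Units.val_mul, Int.cast_mul]
  have hsnd : ∀ (pr : SpinConfig (Fin n) × SpinConfig (Fin n)) (z : Fin n), spinAt z (Φ pr).2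
      = if z ∈ A then spinAt z pr.2 else spinAt c₁ pr.1 * spinAt c₁ pr.2 * spinAt z pr.1 := by
    intro pr z
    subst hΦ
    by_cases hz : z ∈ A <;> simp [spinAt, hz, Units.val_mul, Int.cast_mul]
  rw [← Fintype.sum_prod_type', ← Fintype.sum_prod_type',
    ← Equiv.sum_comp (Function.Involutive.toPerm Φ hinv)]
  refine Finset.sum_congr rfl fun pr _ => ?_
  rw [Function.Involutive.coe_toPerm]
  have hA1 : ∀ z ∈ A, spinAt z (Φ pr).1 = spinAt z pr.1 := fun z hz => by rw [hfst, if_pos hz]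
  have hA2 : ∀ z ∈ A, spinAt z (Φ pr).2 = spinAt z pr.2 := fun z hz => by rw [hsnd, if_pos hz]
  have hFΦ : F (Φ pr).1 = F pr.1 := hF _ _ fun z hz => by
    rw [hΦ]
    dsimp only
    rw [if_pos hz]
  rw [hFΦ, hA1 c₁ hc₁, hA2 c₁ hc₁, hA1 c₂ hc₂, hA2 c₂ hc₂, marg_weightA_congr K C A hA1]
  have htt := marg_sign_sq (spinAt_mul_self c₁ pr.1) (spinAt_mul_self c₁ pr.2)
  by_cases hagree : spinAt c₁ pr.1 * spinAt c₁ pr.2 = spinAt c₂ pr.1 * spinAt c₂ pr.2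
  · -- agreeing sector: on `insert c₁ (insert c₂ Aᶜ)` the second copy is `ω` times the relative sign
    have hB2 : ∀ z ∈ insert c₁ (insert c₂ Aᶜ),
        spinAt z (Φ pr).2 = spinAt c₁ pr.1 * spinAt c₁ pr.2 * spinAt z pr.1 := by
      intro z hz
      rw [hsnd]
      rcases Finset.mem_insert.1 hz with h | hz
      · rw [h, if_pos hc₁, mul_right_comm, spinAt_mul_self, one_mul]
      · rcases Finset.mem_insert.1 hz with h | hz
        · rw [h, if_pos hc₂, hagree, mul_right_comm, spinAt_mul_self, one_mul]
        · rw [if_neg (Finset.mem_compl.1 hz)]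
    rw [marg_weightB_transfer K C hC c₁ c₂ A hAB htt hB2]
  · have h0 : 1 + spinAt c₁ pr.1 * spinAt c₁ pr.2 * (spinAt c₂ pr.1 * spinAt c₂ pr.2) = 0 := by
      have hv := marg_sign_sq (spinAt_mul_self c₂ pr.1) (spinAt_mul_self c₂ pr.2)
      have h : (spinAt c₁ pr.1 * spinAt c₁ pr.2 - spinAt c₂ pr.1 * spinAt c₂ pr.2)
          * (1 + spinAt c₁ pr.1 * spinAt c₁ pr.2 * (spinAt c₂ pr.1 * spinAt c₂ pr.2)) = 0 := by
        linear_combination (spinAt c₂ pr.1 * spinAt c₂ pr.2) * htt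
          - (spinAt c₁ pr.1 * spinAt c₁ pr.2) * hv
      exact (mul_eq_zero.1 h).resolve_left (sub_ne_zero.2 hagree)
    simp only [h0, mul_zero, zero_mul]

/-- `∑_ω σ_{c₁}σ_{c₂} = 0` for `c₁ ≠ c₂` (flip the spin at `c₁`). [folklore] -/
theorem marg_sum_pair_zero {n : ℕ} {c₁ c₂ : Fin n} (hne : c₁ ≠ c₂) :
    ∑ ω : SpinConfig (Fin n), spinAt c₁ ω * spinAt c₂ ω = 0 := by
  have h := Equiv.sum_comp (Equiv.mulRight (Pi.mulSingle c₁ (-1) : SpinConfig (Fin n)))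
    (fun ω => spinAt c₁ ω * spinAt c₂ ω)
  have h1 : ∀ ω : SpinConfig (Fin n), spinAt c₁ (ω * Pi.mulSingle c₁ (-1)) = -spinAt c₁ ω :=
    fun ω => by simp [spinAt, Pi.mulSingle_eq_same, Units.val_neg]
  have h2 : ∀ ω : SpinConfig (Fin n), spinAt c₂ (ω * Pi.mulSingle c₁ (-1)) = spinAt c₂ ω :=
    fun ω => by simp [spinAt, Pi.mulSingle_eq_of_ne hne.symm]
  simp only [Equiv.coe_mulRight, h1, h2, neg_mul, Finset.sum_neg_distrib] at h
  linarith

/-- **Marginalisation across a 2-separator.** For an observable `F` of the spins in `A`,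
`N · S(F) = S_A(F) · Z_B + S_A(F σ_{c₁}σ_{c₂}) · T_B` (`N = #configurations`): summing out the far
side leaves the even factor `Z_B + T_B σ_{c₁}σ_{c₂}`. [folklore] -/
theorem marg_key {n m : ℕ} (K : Fin m → ℝ) (C : Fin m → Finset (Fin n))
    (hC : ∀ i, (C i).card = 2) {c₁ c₂ : Fin n} (A : Finset (Fin n)) (hne : c₁ ≠ c₂)
    (hc₁ : c₁ ∈ A) (hc₂ : c₂ ∈ A) (hAB : ∀ i, C i ⊆ A ∨ C i ⊆ insert c₁ (insert c₂ Aᶜ))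
    (F : SpinConfig (Fin n) → ℝ)
    (hF : ∀ ω ω' : SpinConfig (Fin n), (∀ z ∈ A, ω z = ω' z) → F ω = F ω') :
    (Fintype.card (SpinConfig (Fin n)) : ℝ) * gksSum Finset.univ K C F
      = gksSum (Finset.univ.filter fun i => C i ⊆ A) K C F
          * gksSum (Finset.univ.filter fun i => ¬ C i ⊆ A) K C (fun _ => 1)
        + gksSum (Finset.univ.filter fun i => C i ⊆ A) K C
            (fun ω => F ω * (spinAt c₁ ω * spinAt c₂ ω))
          * gksSum (Finset.univ.filter fun i => ¬ C i ⊆ A) K C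
            (fun ω => spinAt c₁ ω * spinAt c₂ ω) := by
  have h0 : ∑ ω' : SpinConfig (Fin n), spinAt c₁ ω' * spinAt c₂ ω' = 0 := marg_sum_pair_zero hne
  have inner : ∀ ω : SpinConfig (Fin n),
      ∑ ω' : SpinConfig (Fin n),
        F ω * (1 + spinAt c₁ ω * spinAt c₁ ω' * (spinAt c₂ ω * spinAt c₂ ω'))
          * (gksWeight (Finset.univ.filter fun i => C i ⊆ A) K C ω
            * gksWeight (Finset.univ.filter fun i => ¬ C i ⊆ A) K C ω)
        = (Fintype.card (SpinConfig (Fin n)) : ℝ) * (F ω * gksWeight Finset.univ K C ω) := by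
    intro ω
    rw [marg_weight_split K C A ω]
    calc _ = ∑ ω' : SpinConfig (Fin n),
          (F ω * (gksWeight (Finset.univ.filter fun i => C i ⊆ A) K C ω
              * gksWeight (Finset.univ.filter fun i => ¬ C i ⊆ A) K C ω)
            + F ω * (gksWeight (Finset.univ.filter fun i => C i ⊆ A) K C ω
              * gksWeight (Finset.univ.filter fun i => ¬ C i ⊆ A) K C ω)
              * (spinAt c₁ ω * spinAt c₂ ω) * (spinAt c₁ ω' * spinAt c₂ ω')) :=
          Finset.sum_congr rfl fun ω' _ => by ring
      _ = _ := by
        rw [Finset.sum_add_distrib, Finset.sum_const, Finset.card_univ, ← Finset.mul_sum, h0,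
          mul_zero, add_zero, nsmul_eq_mul]
  symm
  calc _ = ∑ ω : SpinConfig (Fin n), ∑ ω' : SpinConfig (Fin n),
        F ω * (1 + spinAt c₁ ω * spinAt c₁ ω' * (spinAt c₂ ω * spinAt c₂ ω'))
          * (gksWeight (Finset.univ.filter fun i => C i ⊆ A) K C ω
            * gksWeight (Finset.univ.filter fun i => ¬ C i ⊆ A) K C ω') := by
        simp only [gksSum]
        rw [Finset.sum_mul_sum, Finset.sum_mul_sum, ← Finset.sum_add_distrib]
        refine Finset.sum_congr rfl fun ω _ => ?_
        rw [← Finset.sum_add_distrib]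
        exact Finset.sum_congr rfl fun ω' _ => by ring
    _ = _ := marg_sum_swap K C hC c₁ c₂ A hc₁ hc₂ hAB F hF
    _ = ∑ ω : SpinConfig (Fin n),
          (Fintype.card (SpinConfig (Fin n)) : ℝ) * (F ω * gksWeight Finset.univ K C ω) :=
        Finset.sum_congr rfl fun ω _ => inner ω
    _ = _ := by rw [← Finset.mul_sum]; simp only [gksSum]

/-- `|T| < Z` for the pair observable `σ_{c₁}σ_{c₂}`, `c₁ ≠ c₂`: both of its signs carry positive
weight. [folklore] -/
theorem marg_corr_lt {n : ℕ} {ι : Type*} (s : Finset ι) (K : ι → ℝ) (C : ι → Finset (Fin n))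
    {c₁ c₂ : Fin n} (hne : c₁ ≠ c₂) :
    gksSum s K C (fun ω => spinAt c₁ ω * spinAt c₂ ω) < gksSum s K C (fun _ => 1) ∧
      -gksSum s K C (fun _ => 1) < gksSum s K C (fun ω => spinAt c₁ ω * spinAt c₂ ω) := by
  have hu : ∀ ω : SpinConfig (Fin n),
      spinAt c₁ ω * spinAt c₂ ω = 1 ∨ spinAt c₁ ω * spinAt c₂ ω = -1 := by
    intro ω
    rcases spinAt_eq_one_or_eq_neg_one c₁ ω with h | h <;>
      rcases spinAt_eq_one_or_eq_neg_one c₂ ω with h' | h' <;> simp [h, h']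
  set ω₀ : SpinConfig (Fin n) := fun z => if z = c₁ then -1 else 1 with hω₀
  have h01 : spinAt c₁ ω₀ = -1 := by simp [hω₀, spinAt]
  have h02 : spinAt c₂ ω₀ = 1 := by simp [hω₀, spinAt, hne.symm]
  constructor
  · rw [← sub_pos]
    simp only [gksSum]
    rw [← Finset.sum_sub_distrib]
    refine Finset.sum_pos' (fun ω _ => ?_) ⟨ω₀, Finset.mem_univ _, ?_⟩
    · rw [← sub_mul]
      refine mul_nonneg ?_ (gksWeight_pos s K C ω).le
      rcases hu ω with h | h <;> rw [h] <;> norm_num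
    · rw [← sub_mul, h01, h02]
      exact mul_pos (by norm_num) (gksWeight_pos s K C _)
  · rw [← sub_pos, sub_neg_eq_add]
    simp only [gksSum]
    rw [← Finset.sum_add_distrib]
    refine Finset.sum_pos' (fun ω _ => ?_) ⟨fun _ => 1, Finset.mem_univ _, ?_⟩
    · rw [← add_mul]
      refine mul_nonneg ?_ (gksWeight_pos s K C ω).le
      rcases hu ω with h | h <;> rw [h] <;> norm_num
    · rw [← add_mul]
      exact mul_pos (by simp [spinAt]) (gksWeight_pos s K C _)

/-- `sinh J = r cosh J` for `J = ½ log((1+r)/(1−r)) = artanh r`, `|r| < 1`. [folklore] -/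
theorem marg_sinh_eq {r : ℝ} (h1 : -1 < r) (h2 : r < 1) :
    Real.sinh (Real.log ((1 + r) / (1 - r)) / 2)
      = r * Real.cosh (Real.log ((1 + r) / (1 - r)) / 2) := by
  have hK : Real.log ((1 + r) / (1 - r)) / 2 = Real.artanh r := by
    rw [Real.artanh_eq_half_log ⟨h1.le, h2.le⟩]
    ring
  have ht := Real.tanh_artanh (show r ∈ Set.Ioo (-1) 1 from ⟨h1, h2⟩)
  rw [Real.tanh_eq_sinh_div_cosh, div_eq_iff (Real.cosh_pos _).ne'] at ht
  rw [hK, ht]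

/-- The system "`A`-bonds (the others switched off) plus one bond `{c₁, c₂}` of coupling `J`"
(index type `Fin m ⊕ Unit`) has sums `cosh J · S_A(f) + sinh J · S_A(f σ_{c₁}σ_{c₂})`. [folklore] -/
theorem marg_gksSum_sum {n m : ℕ} (K : Fin m → ℝ) (C : Fin m → Finset (Fin n))
    (A : Finset (Fin n)) {c₁ c₂ : Fin n} (hne : c₁ ≠ c₂) (J : ℝ) (f : SpinConfig (Fin n) → ℝ) :
    gksSum (Finset.univ : Finset (Fin m ⊕ Unit))
        (Sum.elim (fun i => if C i ⊆ A then K i else 0) (fun _ => J))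
        (Sum.elim C (fun _ => ({c₁, c₂} : Finset (Fin n)))) f
      = Real.cosh J * gksSum (Finset.univ.filter fun i => C i ⊆ A) K C f
        + Real.sinh J * gksSum (Finset.univ.filter fun i => C i ⊆ A) K C
            (fun ω => f ω * (spinAt c₁ ω * spinAt c₂ ω)) := by
  have hw : ∀ ω : SpinConfig (Fin n),
      gksWeight (Finset.univ : Finset (Fin m ⊕ Unit))
          (Sum.elim (fun i => if C i ⊆ A then K i else 0) (fun _ => J))
          (Sum.elim C (fun _ => ({c₁, c₂} : Finset (Fin n)))) ω
        = gksWeight (Finset.univ.filter fun i => C i ⊆ A) K C ω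
          * (Real.cosh J + spinAt c₁ ω * spinAt c₂ ω * Real.sinh J) := by
    intro ω
    have hu : spinAt c₁ ω * spinAt c₂ ω = 1 ∨ spinAt c₁ ω * spinAt c₂ ω = -1 := by
      rcases spinAt_eq_one_or_eq_neg_one c₁ ω with h | h <;>
        rcases spinAt_eq_one_or_eq_neg_one c₂ ω with h' | h' <;> simp [h, h']
    unfold gksWeight gksHamiltonian
    rw [Fintype.sum_sum_type, Fintype.sum_unique (ι := Unit), Real.exp_add, Finset.sum_filter]
    simp only [Sum.elim_inl, Sum.elim_inr, ite_mul, zero_mul]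
    rw [show spinProduct ({c₁, c₂} : Finset (Fin n)) ω = spinAt c₁ ω * spinAt c₂ ω from
      Finset.prod_pair hne, exp_mul_eq_cosh_add_mul_sinh J hu]
  simp only [gksSum, hw]
  rw [Finset.mul_sum, Finset.mul_sum, ← Finset.sum_add_distrib]
  exact Finset.sum_congr rfl fun ω _ => by ring

/-- Parallel composition of the separator correlation: from `N Z = Z_A Z_B + T_A T_B` and
`N T = T_A Z_B + Z_A T_B` to `T/Z = (r_A + r_B)/(1 + r_A r_B)`. [folklore] -/
theorem marg_algebra_one {N Z T ZA TA ZB TB : ℝ} (hN : N ≠ 0) (hZA : ZA ≠ 0) (hZB : ZB ≠ 0)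
    (k1 : N * Z = ZA * ZB + TA * TB) (k2 : N * T = TA * ZB + ZA * TB) :
    T / Z = (TA / ZA + TB / ZB) / (1 + TA / ZA * (TB / ZB)) := by
  have hP : ZA * ZB ≠ 0 := mul_ne_zero hZA hZB
  rw [div_add_div _ _ hZA hZB, div_mul_div_comm, one_add_div hP, ← k1, ← k2,
    div_div_div_cancel_right₀ hP, mul_div_mul_left _ _ hN]

/-- From `r_B Z_B = T_B`, `N S = S_A Z_B + S_A' T_B`, `N Z = Z_A Z_B + T_A T_B`:
`S/Z = (c S_A + r_B c S_A')/(c Z_A + r_B c T_A)` (the effective-bond system). [folklore] -/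
theorem marg_algebra_two {N Z S ZB TB rB c SA SAt ZA TA : ℝ} (hN : N ≠ 0) (hZB : ZB ≠ 0)
    (hc : c ≠ 0) (hTB : rB * ZB = TB) (k : N * S = SA * ZB + SAt * TB)
    (k1 : N * Z = ZA * ZB + TA * TB) :
    S / Z = (c * SA + rB * c * SAt) / (c * ZA + rB * c * TA) := by
  have e1 : ZB * (c * SA + rB * c * SAt) = c * (N * S) := by
    rw [k]; linear_combination c * SAt * hTB
  have e2 : ZB * (c * ZA + rB * c * TA) = c * (N * Z) := by
    rw [k1]; linear_combination c * TA * hTB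
  symm
  rw [← mul_div_mul_left _ _ hZB, e1, e2, mul_div_mul_left _ _ hc, mul_div_mul_left _ _ hN]

/-- Registered stub `helper_marginal_twoSep` (core D, D7 of line `Sketch`): **marginalisation
across a 2-separator.**  Bonds inside `A` or inside `insert c₁ (insert c₂ Aᶜ)` (`c₁ ≠ c₂ ∈ A`);
`r_A`, `r_B` the `c₁c₂`-correlations of the two sides' own systems.  Then
(i) `⟨σ_{c₁}σ_{c₂}⟩ = (r_A + r_B)/(1 + r_A r_B)`, and (ii) for `p, q ∈ A`, `⟨σ_pσ_q⟩` is the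
correlation of "bonds inside `A` plus one extra bond `{c₁,c₂}` of coupling `½ log((1+r_B)/(1−r_B))`"
(index type `Fin m ⊕ Unit`).  Both follow from `marg_key`; the sign of `K` is not used.
[folklore] -/
theorem helper_marginal_twoSep :
    ∀ (n m : ℕ) (K : Fin m → ℝ) (C : Fin m → Finset (Fin n)), (∀ i, 0 ≤ K i) → (∀ i, (C i).card = 2) →
      ∀ (c₁ c₂ : Fin n) (A : Finset (Fin n)), c₁ ≠ c₂ → c₁ ∈ A → c₂ ∈ A →
        (∀ i, C i ⊆ A ∨ C i ⊆ insert c₁ (insert c₂ Aᶜ)) →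
        (gksExpect Finset.univ K C (fun ω => spinAt c₁ ω * spinAt c₂ ω) =
            (gksExpect (Finset.univ.filter (fun i => C i ⊆ A)) K C (fun ω => spinAt c₁ ω * spinAt c₂ ω)
              + gksExpect (Finset.univ.filter (fun i => ¬ C i ⊆ A)) K C (fun ω => spinAt c₁ ω * spinAt c₂ ω)) /
            (1 + gksExpect (Finset.univ.filter (fun i => C i ⊆ A)) K C (fun ω => spinAt c₁ ω * spinAt c₂ ω)
              * gksExpect (Finset.univ.filter (fun i => ¬ C i ⊆ A)) K C (fun ω => spinAt c₁ ω * spinAt c₂ ω))) ∧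
        (∀ p q : Fin n, p ∈ A → q ∈ A →
          gksExpect Finset.univ K C (fun ω => spinAt p ω * spinAt q ω) =
            gksExpect (Finset.univ : Finset (Fin m ⊕ Unit))
              (Sum.elim (fun i => if C i ⊆ A then K i else 0)
                (fun _ => Real.log ((1 + gksExpect (Finset.univ.filter (fun i => ¬ C i ⊆ A)) K C
                      (fun ω => spinAt c₁ ω * spinAt c₂ ω)) /
                    (1 - gksExpect (Finset.univ.filter (fun i => ¬ C i ⊆ A)) K C
                      (fun ω => spinAt c₁ ω * spinAt c₂ ω))) / 2))
              (Sum.elim C (fun _ => ({c₁, c₂} : Finset (Fin n))))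
              (fun ω => spinAt p ω * spinAt q ω)) := by
  intro n m K C _ hC c₁ c₂ A hne hc₁ hc₂ hAB
  simp only [gksExpect]
  have hN : (Fintype.card (SpinConfig (Fin n)) : ℝ) ≠ 0 := Nat.cast_ne_zero.2 Fintype.card_ne_zero
  have hZA := (gksSum_one_pos (Finset.univ.filter fun i => C i ⊆ A) K C).ne'
  have hZB := gksSum_one_pos (Finset.univ.filter fun i => ¬ C i ⊆ A) K C
  have ht : ∀ ω ω' : SpinConfig (Fin n), (∀ z ∈ A, ω z = ω' z) →
      spinAt c₁ ω * spinAt c₂ ω = spinAt c₁ ω' * spinAt c₂ ω' := fun ω ω' h => by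
    simp only [spinAt, h c₁ hc₁, h c₂ hc₂]
  have key1 := marg_key K C hC A hne hc₁ hc₂ hAB (fun _ => (1 : ℝ)) fun _ _ _ => rfl
  simp only [one_mul] at key1
  refine ⟨?_, fun p q hp hq => ?_⟩
  · have key2 := marg_key K C hC A hne hc₁ hc₂ hAB (fun ω => spinAt c₁ ω * spinAt c₂ ω) ht
    have e : ∀ ω : SpinConfig (Fin n),
        spinAt c₁ ω * spinAt c₂ ω * (spinAt c₁ ω * spinAt c₂ ω) = 1 :=
      fun ω => marg_sign_sq (spinAt_mul_self c₁ ω) (spinAt_mul_self c₂ ω)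
    simp only [e] at key2
    exact marg_algebra_one hN hZA hZB.ne' key1 key2
  · have keyF := marg_key K C hC A hne hc₁ hc₂ hAB (fun ω => spinAt p ω * spinAt q ω)
      fun ω ω' h => by simp only [spinAt, h p hp, h q hq]
    obtain ⟨hT1, hT2⟩ := marg_corr_lt (Finset.univ.filter fun i => ¬ C i ⊆ A) K C hne
    rw [marg_gksSum_sum K C A hne _ (fun ω => spinAt p ω * spinAt q ω),
      marg_gksSum_sum K C A hne _ (fun _ => (1 : ℝ)),
      marg_sinh_eq ((lt_div_iff₀ hZB).2 ((neg_one_mul _).trans_lt hT2)) ((div_lt_one hZB).2 hT1)]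
    simp only [one_mul]
    exact marg_algebra_two hN hZB.ne' (Real.cosh_pos _).ne' (div_mul_cancel₀ _ hZB.ne') keyF key1

end Summit.CriticalPhenomena.Ising3DConformalLimit.Cruxes.InverseMFerromagnet.PartialCovarianceLadder
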